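import Summits.Langlands.Langlands.Theorems.ExteriorSquareAscentReducibleInducesSquareStubNoPlanesAnalyticCores

/-!
# Stub `stub_noPlanesAnalytic` of line `Sketch` for crux stmt-Langlands-18054 — IV: the `(2,2)` case on
the unitary axis, from the automorphic data

(`Summit.Langlands.Langlands.Theses.ExteriorSquareAscent.ReducibleInducesSquare`; serving the glue item
stmt-Langlands-18147 `ReducibleInducesSquareGivenJSAR`.)

`false_of_unitary_pairChar_twoTwo`: let `P` be a cuspidal datum on `GL₄(𝔸_F)` with unitary a.e. Satake
family `α`, NOT essentially self-dual at Satake level, `Pd` a datum with the inverse family, `P₆` a cuspidal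
datum on `GL₆(𝔸_F)` with family `∧² α`, and `χ` a UNITARY (at every uniformizer) Hecke character such that
a.e. `α_w = β_w ⊔ γ_w` with `|β_w| = 2`, `∏ β_w = χ(ϖ_w)`.  Granting Jacquet–Shalika (2.2) and (2.3) for
Borel–Jacquet data: `False`.  With `ω(ϖ) = ∏ α` and `λ = ω χ⁻²`: if `λ(ϖ_w) = 1` a.e. then
`α⁻¹ = χ(ϖ)⁻¹·α` a.e. (a pair is self-dual up to its determinant), i.e. `P` IS essentially self-dual;
otherwise the twelve slots of the `(2,2)` identity (twists `Pd ⊗ λ`, `Pd ⊗ λ²`, `P ⊗ λχ⁻¹`, `Pd ⊗ χλ²`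
and the `GL(1)` data of `λ³, λχ⁻¹, λ, λ², χ⁻¹, λ²χ⁻¹`) carry analytic packages, the Euler factors satisfy
`satakePairPolynomial_twoTwo_identity`, and `false_of_twoTwo_eulerIdentity_of_poles` concludes — the two
`GL₄ × GL₄` pairs on the right being off `X` by NON-essential-self-duality, `L(λ)` by `λ ≠ 1`, and
`λ² = 1 ⇒ π ⊗ λ² ≅ π` coupling the fourth slot on the right to the second on the left.
-/

set_option linter.dupNamespace false -- `Summit.Langlands.Langlands` is the mandated namespace

noncomputable section

namespace Summit.Langlands.Langlands.Cruxes.ReducibleInducesSquare.Sketch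

open Literature.NumberTheory.GaloisRepresentations Literature.NumberTheory.Automorphic
open NumberField IsDedekindDomain Filter Polynomial
open scoped Classical MatrixGroups NumberField Topology

variable {F : Type} [Field F] [NumberField F] in
/-- `(χ₁ χ₂)(ϖ_v) = χ₁(ϖ_v) χ₂(ϖ_v)`. [folklore] -/
private theorem np_vAU_mul (χ₁ χ₂ : HeckeCharacter F) (v : HeightOneSpectrum (𝓞 F)) :
    (χ₁ * χ₂).valueAtUniformizer v = χ₁.valueAtUniformizer v * χ₂.valueAtUniformizer v := by
  simp only [Literature.NumberTheory.GaloisRepresentations.HeckeCharacter.valueAtUniformizer,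
    Literature.NumberTheory.GaloisRepresentations.HeckeCharacter.localComponent_apply,
    Literature.NumberTheory.GaloisRepresentations.HeckeCharacter.mul_apply, Units.val_mul]

variable {F : Type} [Field F] [NumberField F] in
/-- `χ⁻¹(ϖ_v) = χ(ϖ_v)⁻¹`. [folklore] -/
private theorem np_vAU_inv (χ : HeckeCharacter F) (v : HeightOneSpectrum (𝓞 F)) :
    χ⁻¹.valueAtUniformizer v = (χ.valueAtUniformizer v)⁻¹ := by
  simp only [Literature.NumberTheory.GaloisRepresentations.HeckeCharacter.valueAtUniformizer,
    Literature.NumberTheory.GaloisRepresentations.HeckeCharacter.localComponent_apply,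
    Literature.NumberTheory.GaloisRepresentations.HeckeCharacter.inv_apply, Units.val_inv_eq_inv_val]

variable {F : Type} [Field F] [NumberField F] in
/-- `χ(ϖ_v) ≠ 0`. [folklore] -/
private theorem np_vAU_ne_zero (χ : HeckeCharacter F) (v : HeightOneSpectrum (𝓞 F)) :
    χ.valueAtUniformizer v ≠ 0 := by
  simp only [Literature.NumberTheory.GaloisRepresentations.HeckeCharacter.valueAtUniformizer,
    Literature.NumberTheory.GaloisRepresentations.HeckeCharacter.localComponent_apply]
  exact Units.ne_zero _

section DataOn

variable {F : Type} [Field F] [NumberField F]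

/-- The `X`-condition of a `GL(1) × GL(1)` slot `({θ(ϖ)}, {1})` at `s₀ = 1` says `θ(ϖ_w) = 1` a.e. [folklore] -/
theorem np_eventually_eq_one_of_X {θ : HeckeCharacter F}
    (h : ∀ᶠ w : HeightOneSpectrum (𝓞 F) in cofinite,
      (({θ.valueAtUniformizer w} : Multiset ℂ)).map ((((w.residueCard : ℂ) ^ (1 - (1 : ℂ)))) * ·) =
        (({1} : Multiset ℂ)).map (·⁻¹)) :
    ∀ᶠ w : HeightOneSpectrum (𝓞 F) in cofinite, θ.valueAtUniformizer w = 1 :=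
  h.mono fun w hw => by
    simpa only [Multiset.map_singleton, sub_self, Complex.cpow_zero, one_mul, inv_one,
      Multiset.singleton_inj] using hw

/-- `((c · M)⁻¹)⁻¹`-bookkeeping: `(c · M⁻¹)⁻¹ = c⁻¹ · M`. [folklore] -/
theorem np_map_inv_map_mul_map_inv (M : Multiset ℂ) (c : ℂ) :
    ((M.map (·⁻¹)).map (c * ·)).map (·⁻¹) = M.map (c⁻¹ * ·) := by
  simp only [Multiset.map_map, Function.comp_def, mul_inv, inv_inv]

/-- **The `(2,2)` case ON the unitary axis** (module docstring).
[cite: Shavali2026, Prop. 4.2] [cite: ArthurClozelAMS120, Ch. 3 §2 (2.1)–(2.3)]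
[cite: JacquetShalikaAJM1981II, Prop. 3.6 and Thm. 4.4] -/
theorem false_of_unitary_pairChar_twoTwo
    (hJ2 : JacquetShalika1981_partialPairL_boundary_repData)
    (hJ3 : JacquetShalika1981_partialPairL_pole_repData)
    {h4 : isCompact_glFiniteIntegralLevel 4 F} {h6 : isCompact_glFiniteIntegralLevel 6 F}
    (P Pd : CuspidalAutomorphicRepData 4 F h4) (P₆ : CuspidalAutomorphicRepData 6 F h6)
    (α : SatakeFamily F)
    (hP : ∀ᶠ w : HeightOneSpectrum (𝓞 F) in cofinite, P.1.HasSatakeParamAt w (α w))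
    (hPd : ∀ᶠ w : HeightOneSpectrum (𝓞 F) in cofinite, Pd.1.HasSatakeParamAt w ((α w).map (·⁻¹)))
    (hP₆ : ∀ᶠ w : HeightOneSpectrum (𝓞 F) in cofinite, P₆.1.HasSatakeParamAt w (wedgeTwoParams (α w)))
    (huα : ∀ᶠ w : HeightOneSpectrum (𝓞 F) in cofinite, ‖(α w).prod‖ = 1)
    (hNE : ¬ ∃ e : HeckeCharacter F, ∀ᶠ w : HeightOneSpectrum (𝓞 F) in cofinite,
      (α w).map (·⁻¹) = (α w).map (e.valueAtUniformizer w * ·))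
    (χ : HeckeCharacter F) (hχ1 : ∀ w : HeightOneSpectrum (𝓞 F), ‖χ.valueAtUniformizer w‖ = 1)
    (hsplit : ∀ᶠ w : HeightOneSpectrum (𝓞 F) in cofinite, ∃ β γ : Multiset ℂ,
      β + γ = α w ∧ Multiset.card β = 2 ∧ β.prod = χ.valueAtUniformizer w) :
    False := by
  have h1 : isCompact_glFiniteIntegralLevel 1 F := isCompact_glFiniteIntegralLevel_holds 1 F
  haveI : NeZero (4 : ℕ) := ⟨by norm_num⟩
  haveI : NeZero (6 : ℕ) := ⟨by norm_num⟩
  obtain ⟨Ω, hΩ⟩ := centralCharacter_satake_of_cuspidal P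
  set lam : HeckeCharacter F := Ω * χ⁻¹ * χ⁻¹ with hlamdef
  -- the good places: `α` is the Satake parameter of `P`, `Ω(ϖ) = ∏ α`, the splitting
  have hgood : ∀ᶠ w : HeightOneSpectrum (𝓞 F) in cofinite, P.1.HasSatakeParamAt w (α w) ∧
      Ω.valueAtUniformizer w = (α w).prod ∧ ∃ β γ : Multiset ℂ,
        β + γ = α w ∧ Multiset.card β = 2 ∧ β.prod = χ.valueAtUniformizer w := by
    filter_upwards [hP, hΩ, hsplit] with w h₁ h₂ h₃
    exact ⟨h₁, h₂ _ h₁, h₃⟩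
  -- pointwise consequences at a good place
  have hpt : ∀ {w : HeightOneSpectrum (𝓞 F)} {β γ : Multiset ℂ}, P.1.HasSatakeParamAt w (α w) →
      Ω.valueAtUniformizer w = (α w).prod → β + γ = α w → Multiset.card β = 2 →
      β.prod = χ.valueAtUniformizer w →
      (0 : ℂ) ∉ β ∧ (0 : ℂ) ∉ γ ∧ Multiset.card γ = 2 ∧
        γ.prod = lam.valueAtUniformizer w * χ.valueAtUniformizer w := by
    intro w β γ hPw hΩw hβγ hβ2 hx
    have h0 : (0 : ℂ) ∉ α w := fun h0 => hasSatakeParamAt_ne_zero_holds hPw 0 h0 rfl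
    have hβ0 : (0 : ℂ) ∉ β := fun h => h0 (hβγ ▸ Multiset.mem_add.2 (Or.inl h))
    have hγ0 : (0 : ℂ) ∉ γ := fun h => h0 (hβγ ▸ Multiset.mem_add.2 (Or.inr h))
    have hγ2 : Multiset.card γ = 2 := by
      have h4 := hPw.card_eq
      rw [← hβγ, Multiset.card_add, hβ2] at h4
      omega
    have hx0 : χ.valueAtUniformizer w ≠ 0 := np_vAU_ne_zero χ w
    refine ⟨hβ0, hγ0, hγ2, ?_⟩
    rw [hlamdef, np_vAU_mul, np_vAU_mul, np_vAU_inv, hΩw, ← hβγ, Multiset.prod_add, hx]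
    field_simp
  by_cases hlam1 : ∀ᶠ w : HeightOneSpectrum (𝓞 F) in cofinite, lam.valueAtUniformizer w = 1
  · -- `λ = 1` a.e.: then `α⁻¹ = χ(ϖ)⁻¹ · α` a.e., i.e. `P` IS essentially self-dual
    refine hNE ⟨χ⁻¹, ?_⟩
    filter_upwards [hgood, hlam1] with w hw hlw
    obtain ⟨hPw, hΩw, β, γ, hβγ, hβ2, hx⟩ := hw
    obtain ⟨hβ0, hγ0, hγ2, hy⟩ := hpt hPw hΩw hβγ hβ2 hx
    rw [hlw, one_mul] at hy
    rw [np_vAU_inv, ← hβγ, Multiset.map_add, Multiset.map_add, np_map_inv_of_card_eq_two hβ2 hβ0,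
      np_map_inv_of_card_eq_two hγ2 hγ0, hx, hy]
  -- `λ ≠ 1`: the data of the twelve slots
  have hnΩ : ∀ᶠ w : HeightOneSpectrum (𝓞 F) in cofinite, ‖Ω.valueAtUniformizer w‖ = 1 := by
    filter_upwards [hgood, huα] with w hw hu
    rw [hw.2.1, hu]
  have hnχi : ∀ w, ‖χ⁻¹.valueAtUniformizer w‖ = 1 := fun w => by rw [np_vAU_inv, norm_inv, hχ1, inv_one]
  have hnlam : ∀ᶠ w : HeightOneSpectrum (𝓞 F) in cofinite, ‖lam.valueAtUniformizer w‖ = 1 :=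
    hnΩ.mono fun w hw => by rw [hlamdef, np_vAU_mul, np_vAU_mul, norm_mul, norm_mul, hw, hnχi, one_mul, one_mul]
  have hn2 : ∀ {θ₁ θ₂ : HeckeCharacter F}, (∀ᶠ w : HeightOneSpectrum (𝓞 F) in cofinite,
      ‖θ₁.valueAtUniformizer w‖ = 1) → (∀ᶠ w : HeightOneSpectrum (𝓞 F) in cofinite,
      ‖θ₂.valueAtUniformizer w‖ = 1) →
      ∀ᶠ w : HeightOneSpectrum (𝓞 F) in cofinite, ‖(θ₁ * θ₂).valueAtUniformizer w‖ = 1 :=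
    fun h₁ h₂ => by
    filter_upwards [h₁, h₂] with w hw₁ hw₂
    rw [np_vAU_mul, norm_mul, hw₁, hw₂, one_mul]
  have hnχi' : ∀ᶠ w : HeightOneSpectrum (𝓞 F) in cofinite, ‖χ⁻¹.valueAtUniformizer w‖ = 1 :=
    Eventually.of_forall hnχi
  have hnχ' : ∀ᶠ w : HeightOneSpectrum (𝓞 F) in cofinite, ‖χ.valueAtUniformizer w‖ = 1 :=
    Eventually.of_forall hχ1
  -- unitarity of the families
  have huαd : ∀ᶠ w : HeightOneSpectrum (𝓞 F) in cofinite, ‖((α w).map (·⁻¹)).prod‖ = 1 :=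
    huα.mono fun w hw => by rw [Multiset.prod_map_inv, Multiset.map_id', norm_inv, hw, inv_one]
  have huB : ∀ᶠ w : HeightOneSpectrum (𝓞 F) in cofinite, ‖(wedgeTwoParams (α w)).prod‖ = 1 := by
    filter_upwards [hP, huα] with w hPw hu
    rw [prod_wedgeTwoParams, hPw.card_eq, norm_pow, hu, one_pow]
  have hutw : ∀ {θ : HeckeCharacter F} {M : SatakeFamily F},
      (∀ᶠ w : HeightOneSpectrum (𝓞 F) in cofinite, ‖θ.valueAtUniformizer w‖ = 1) →
      (∀ᶠ w : HeightOneSpectrum (𝓞 F) in cofinite, ‖(M w).prod‖ = 1) →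
      ∀ᶠ w : HeightOneSpectrum (𝓞 F) in cofinite, ‖((M w).map (θ.valueAtUniformizer w * ·)).prod‖ = 1 :=
    fun h₁ h₂ => by
    filter_upwards [h₁, h₂] with w hw₁ hw₂
    rw [prod_map_const_mul_eq, norm_mul, norm_pow, hw₁, hw₂, one_pow, one_mul]
  have hu1 : ∀ {θ : HeckeCharacter F},
      (∀ᶠ w : HeightOneSpectrum (𝓞 F) in cofinite, ‖θ.valueAtUniformizer w‖ = 1) →
      ∀ᶠ w : HeightOneSpectrum (𝓞 F) in cofinite, ‖(({θ.valueAtUniformizer w} : Multiset ℂ)).prod‖ = 1 :=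
    fun h => h.mono fun w hw => by rw [Multiset.prod_singleton, hw]
  have huone : ∀ᶠ w : HeightOneSpectrum (𝓞 F) in cofinite, ‖(({1} : Multiset ℂ)).prod‖ = 1 :=
    Eventually.of_forall fun w => by rw [Multiset.prod_singleton, norm_one]
  -- the automorphic data
  obtain ⟨Q₁, hQ₁⟩ := CuspidalAutomorphicRepData.exists_twist_hecke_hasSatakeParamAt lam Pd
  obtain ⟨Q₂, hQ₂⟩ := CuspidalAutomorphicRepData.exists_twist_hecke_hasSatakeParamAt (lam * lam) Pd
  obtain ⟨Qa, hQa⟩ := CuspidalAutomorphicRepData.exists_twist_hecke_hasSatakeParamAt (lam * χ⁻¹) P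
  obtain ⟨Qb, hQb⟩ := CuspidalAutomorphicRepData.exists_twist_hecke_hasSatakeParamAt (χ * lam * lam) Pd
  obtain ⟨τ₀, hτ₀⟩ := exists_cuspidal_glOne_hasSatakeParamAt_one h1
  obtain ⟨τ₃, hτ₃⟩ := exists_cuspidal_glOne_hasSatakeParamAt_valueAtUniformizer h1 (lam * lam * lam)
  obtain ⟨τ₁, hτ₁⟩ := exists_cuspidal_glOne_hasSatakeParamAt_valueAtUniformizer h1 lam
  obtain ⟨τ₂, hτ₂⟩ := exists_cuspidal_glOne_hasSatakeParamAt_valueAtUniformizer h1 (lam * lam)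
  -- the families
  set αd : SatakeFamily F := fun w => (α w).map (·⁻¹) with hαd
  set A₁ : SatakeFamily F := fun w => (αd w).map (lam.valueAtUniformizer w * ·) with hA₁
  set A₂ : SatakeFamily F := fun w => (αd w).map ((lam * lam).valueAtUniformizer w * ·) with hA₂
  set Aa : SatakeFamily F := fun w => (α w).map ((lam * χ⁻¹).valueAtUniformizer w * ·) with hAa
  set Ab : SatakeFamily F := fun w => (αd w).map ((χ * lam * lam).valueAtUniformizer w * ·) with hAb
  set one : SatakeFamily F := fun _ => {1} with hone
  set u₃ : SatakeFamily F := fun w => {(lam * lam * lam).valueAtUniformizer w} with hu₃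
  set uκ : SatakeFamily F := fun w => {(lam * χ⁻¹).valueAtUniformizer w} with huκ
  set u₁ : SatakeFamily F := fun w => {lam.valueAtUniformizer w} with hu₁
  set u₂ : SatakeFamily F := fun w => {(lam * lam).valueAtUniformizer w} with hu₂
  set ue : SatakeFamily F := fun w => {χ⁻¹.valueAtUniformizer w} with hue
  set uf : SatakeFamily F := fun w => {(lam * lam * χ⁻¹).valueAtUniformizer w} with huf
  set B₆ : SatakeFamily F := fun w => wedgeTwoParams (α w) with hB₆
  -- their Satake statements
  have hQ₁' : ∀ᶠ w : HeightOneSpectrum (𝓞 F) in cofinite, Q₁.1.HasSatakeParamAt w (A₁ w) := by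
    filter_upwards [hPd, hQ₁] with w h h'; exact h' _ h
  have hQ₂' : ∀ᶠ w : HeightOneSpectrum (𝓞 F) in cofinite, Q₂.1.HasSatakeParamAt w (A₂ w) := by
    filter_upwards [hPd, hQ₂] with w h h'; exact h' _ h
  have hQa' : ∀ᶠ w : HeightOneSpectrum (𝓞 F) in cofinite, Qa.1.HasSatakeParamAt w (Aa w) := by
    filter_upwards [hP, hQa] with w h h'; exact h' _ h
  have hQb' : ∀ᶠ w : HeightOneSpectrum (𝓞 F) in cofinite, Qb.1.HasSatakeParamAt w (Ab w) := by
    filter_upwards [hPd, hQb] with w h h'; exact h' _ h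
  -- the eleven analytic packages
  obtain ⟨S₁, hS₁, pk₁⟩ := analyticPackage_fourFour hJ2 hJ3 P Q₁ α A₁ hP hQ₁' huα (hutw hnlam huαd)
  obtain ⟨S₂, hS₂, pk₂⟩ := analyticPackage_fourFour hJ2 hJ3 P Q₂ α A₂ hP hQ₂' huα
    (hutw (hn2 hnlam hnlam) huαd)
  obtain ⟨S₃, hS₃, pk₃⟩ := analyticPackage_oneOne τ₀ τ₀ one one hτ₀ hτ₀ huone huone
  obtain ⟨S₄, hS₄, pk₄⟩ := analyticPackage_oneOne τ₃ τ₀ u₃ one hτ₃ hτ₀ (hu1 (hn2 (hn2 hnlam hnlam) hnlam))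
    huone
  obtain ⟨S₅, hS₅, pk₅⟩ := analyticPackage_repData hJ2 (n := 6) (by norm_num) P₆ B₆ hP₆ huB (lam * χ⁻¹)
    (hn2 hnlam hnχi')
  obtain ⟨Sa, hSa, pka⟩ := analyticPackage_fourFour hJ2 hJ3 P Qa α Aa hP hQa' huα
    (hutw (hn2 hnlam hnχi') huα)
  obtain ⟨Sb, hSb, pkb⟩ := analyticPackage_fourFour hJ2 hJ3 Pd Qb αd Ab hPd hQb' huαd
    (hutw (hn2 (hn2 hnχ' hnlam) hnlam) huαd)
  obtain ⟨Sc, hSc, pkc⟩ := analyticPackage_oneOne τ₁ τ₀ u₁ one hτ₁ hτ₀ (hu1 hnlam) huone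
  obtain ⟨Sd, hSd, pkd⟩ := analyticPackage_oneOne τ₂ τ₀ u₂ one hτ₂ hτ₀ (hu1 (hn2 hnlam hnlam)) huone
  obtain ⟨Se, hSe, pke⟩ := analyticPackage_repData hJ2 (n := 6) (by norm_num) P₆ B₆ hP₆ huB χ⁻¹ hnχi'
  obtain ⟨Sf, hSf, pkf⟩ := analyticPackage_repData hJ2 (n := 6) (by norm_num) P₆ B₆ hP₆ huB
    (lam * lam * χ⁻¹) (hn2 (hn2 hnlam hnlam) hnχi')
  obtain ⟨E, hE, hgoodE⟩ : ∃ E : Set (HeightOneSpectrum (𝓞 F)), E.Finite ∧ ∀ w ∉ E,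
      P.1.HasSatakeParamAt w (α w) ∧ Ω.valueAtUniformizer w = (α w).prod ∧ ∃ β γ : Multiset ℂ,
        β + γ = α w ∧ Multiset.card β = 2 ∧ β.prod = χ.valueAtUniformizer w :=
    ⟨_, Filter.eventually_cofinite.1 hgood, fun w hw => not_not.1 hw⟩
  set T : Set (HeightOneSpectrum (𝓞 F)) :=
    E ∪ S₁ ∪ S₂ ∪ S₃ ∪ S₄ ∪ S₅ ∪ Sa ∪ Sb ∪ Sc ∪ Sd ∪ Se ∪ Sf with hT_def
  have hT : T.Finite := ((((((((((hE.union hS₁).union hS₂).union hS₃).union hS₄).union hS₅).union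
    hSa).union hSb).union hSc).union hSd).union hSe).union hSf
  have subE : E ⊆ T := fun x hx => by simp [hT_def, hx]
  have sub₁ : S₁ ⊆ T := fun x hx => by simp [hT_def, hx]
  have sub₂ : S₂ ⊆ T := fun x hx => by simp [hT_def, hx]
  have sub₃ : S₃ ⊆ T := fun x hx => by simp [hT_def, hx]
  have sub₄ : S₄ ⊆ T := fun x hx => by simp [hT_def, hx]
  have sub₅ : S₅ ⊆ T := fun x hx => by simp [hT_def, hx]
  have suba : Sa ⊆ T := fun x hx => by simp [hT_def, hx]
  have subb : Sb ⊆ T := fun x hx => by simp [hT_def, hx]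
  have subc : Sc ⊆ T := fun x hx => by simp [hT_def, hx]
  have subd : Sd ⊆ T := fun x hx => by simp [hT_def, hx]
  have sube : Se ⊆ T := fun x hx => by simp [hT_def, hx]
  have subf : Sf ⊆ T := fun x hx => by simp [hT_def, hx]
  -- the `X`-conditions that fail: the right-hand `GL₄ × GL₄` pairs (NOT ess. self-dual) and `L(λ)`
  have hXa : ¬ ∀ᶠ w : HeightOneSpectrum (𝓞 F) in cofinite,
      (α w).map ((((w.residueCard : ℂ) ^ (1 - (1 : ℂ)))) * ·) = (Aa w).map (·⁻¹) := by
    intro hX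
    refine hNE ⟨lam * χ⁻¹, ?_⟩
    filter_upwards [hX] with w hw
    simp only [sub_self, Complex.cpow_zero, one_mul, Multiset.map_id', hAa] at hw
    exact (congrArg (Multiset.map (·⁻¹)) hw).trans (satakeParam_inv_inv _)
  have hXb : ¬ ∀ᶠ w : HeightOneSpectrum (𝓞 F) in cofinite,
      (αd w).map ((((w.residueCard : ℂ) ^ (1 - (1 : ℂ)))) * ·) = (Ab w).map (·⁻¹) := by
    intro hX
    refine hNE ⟨(χ * lam * lam)⁻¹, ?_⟩
    filter_upwards [hX] with w hw
    simp only [sub_self, Complex.cpow_zero, one_mul, Multiset.map_id', hAb, hαd,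
      np_map_inv_map_mul_map_inv] at hw
    rw [np_vAU_inv]
    exact hw
  have hXc : ¬ ∀ᶠ w : HeightOneSpectrum (𝓞 F) in cofinite,
      (u₁ w).map ((((w.residueCard : ℂ) ^ (1 - (1 : ℂ)))) * ·) = (one w).map (·⁻¹) :=
    fun hX => hlam1 (np_eventually_eq_one_of_X hX)
  -- conclude by the abstract core
  refine false_of_twoTwo_eulerIdentity_of_poles α A₁ A₂ one u₃ B₆ uκ Aa αd Ab u₁ u₂ ue uf hT
    (fun _ => rfl) ?_ ?_ ?_ ?_ ?_ ?_ ?_ ?_ ?_ ?_ ?_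
  · -- multipliability of the eleven Euler products
    intro S hS hTS s hs
    exact ⟨(pk₁ hS (sub₁.trans hTS)).1 s hs, (pk₂ hS (sub₂.trans hTS)).1 s hs,
      (pk₃ hS (sub₃.trans hTS)).1 s hs, (pk₄ hS (sub₄.trans hTS)).1 s hs,
      (pk₅ hS (sub₅.trans hTS)).1 s hs, (pka hS (suba.trans hTS)).1 s hs,
      (pkb hS (subb.trans hTS)).1 s hs, (pkc hS (subc.trans hTS)).1 s hs,
      (pkd hS (subd.trans hTS)).1 s hs, (pke hS (sube.trans hTS)).1 s hs,
      (pkf hS (subf.trans hTS)).1 s hs⟩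
  · -- slot 1: `L(π × π^∨ ⊗ λ)`, at most a simple pole
    intro S hS hTS
    obtain ⟨-, -, hoff, hon⟩ := pk₁ hS (sub₁.trans hTS)
    obtain ⟨k, c, hc, -, h⟩ := exists_pow_mul_tendsto_of_package hoff hon
    exact ⟨k, c, hc, h⟩
  · -- slots 2 and d: `λ² = 1` a.e. couples `L(λ²)` to `L(π × π^∨ ⊗ λ²)`
    intro S hS hTS
    obtain ⟨-, -, hoff₂, hon₂⟩ := pk₂ hS (sub₂.trans hTS)
    obtain ⟨-, -, hoffd, hond⟩ := pkd hS (subd.trans hTS)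
    by_cases hXd : ∀ᶠ w : HeightOneSpectrum (𝓞 F) in cofinite,
        (u₂ w).map ((((w.residueCard : ℂ) ^ (1 - (1 : ℂ)))) * ·) = (one w).map (·⁻¹)
    · have hX₂ : ∀ᶠ w : HeightOneSpectrum (𝓞 F) in cofinite,
          (α w).map ((((w.residueCard : ℂ) ^ (1 - (1 : ℂ)))) * ·) = (A₂ w).map (·⁻¹) := by
        filter_upwards [np_eventually_eq_one_of_X hXd] with w hw
        simp only [hA₂, hαd, hw, one_mul, Multiset.map_id', sub_self, Complex.cpow_zero, satakeParam_inv_inv]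
      obtain ⟨c₂, hc₂, h₂⟩ := hon₂ hX₂
      obtain ⟨cd, -, hd⟩ := hond hXd
      exact ⟨1, 1, c₂, cd, hc₂, le_rfl, by simpa only [pow_one] using h₂,
        by simpa only [pow_one] using hd⟩
    · obtain ⟨cd, -, hd⟩ := hoffd hXd
      obtain ⟨k, c, hc, -, h⟩ := exists_pow_mul_tendsto_of_package hoff₂ hon₂
      exact ⟨k, 0, c, cd, hc, Nat.zero_le _, h, by simpa only [pow_zero, one_mul] using hd⟩
  · -- slot 4: `L(λ³)`
    intro S hS hTS
    obtain ⟨-, -, hoff, hon⟩ := pk₄ hS (sub₄.trans hTS)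
    obtain ⟨k, c, hc, -, h⟩ := exists_pow_mul_tendsto_of_package hoff hon
    exact ⟨k, c, hc, h⟩
  · -- slot 5: `L(Π ⊗ λχ⁻¹)`
    intro S hS hTS
    exact (pk₅ hS (sub₅.trans hTS)).2.2
  · intro S hS hTS
    obtain ⟨-, -, hoff, -⟩ := pka hS (suba.trans hTS)
    obtain ⟨c, -, h⟩ := hoff hXa
    exact ⟨c, h⟩
  · intro S hS hTS
    obtain ⟨-, -, hoff, -⟩ := pkb hS (subb.trans hTS)
    obtain ⟨c, -, h⟩ := hoff hXb
    exact ⟨c, h⟩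
  · intro S hS hTS
    obtain ⟨-, -, hoff, -⟩ := pkc hS (subc.trans hTS)
    obtain ⟨c, -, h⟩ := hoff hXc
    exact ⟨c, h⟩
  · intro S hS hTS
    obtain ⟨c, -, h⟩ := (pke hS (sube.trans hTS)).2.2
    exact ⟨c, h⟩
  · intro S hS hTS
    obtain ⟨c, -, h⟩ := (pkf hS (subf.trans hTS)).2.2
    exact ⟨c, h⟩
  · -- the Euler-factor identity at a good place
    intro w hw
    obtain ⟨hPw, hΩw, β, γ, hβγ, hβ2, hx⟩ := hgoodE w (fun h => hw (subE h))
    obtain ⟨hβ0, hγ0, hγ2, hy⟩ := hpt hPw hΩw hβγ hβ2 hx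
    have hx0 : χ.valueAtUniformizer w ≠ 0 := np_vAU_ne_zero χ w
    have hl0 : lam.valueAtUniformizer w ≠ 0 := np_vAU_ne_zero lam w
    have e3 : lam.valueAtUniformizer w * lam.valueAtUniformizer w * lam.valueAtUniformizer w =
        lam.valueAtUniformizer w ^ 3 := by ring
    have eb : χ.valueAtUniformizer w * lam.valueAtUniformizer w * lam.valueAtUniformizer w =
        χ.valueAtUniformizer w * lam.valueAtUniformizer w ^ 2 := by ring
    have ef : lam.valueAtUniformizer w * lam.valueAtUniformizer w * (χ.valueAtUniformizer w)⁻¹ =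
        lam.valueAtUniformizer w ^ 2 * (χ.valueAtUniformizer w)⁻¹ := by ring
    have e2 : lam.valueAtUniformizer w * lam.valueAtUniformizer w = lam.valueAtUniformizer w ^ 2 := by ring
    simp only [hA₁, hA₂, hAa, hAb, hαd, hone, hu₃, huκ, hu₁, hu₂, hue, huf, hB₆, np_vAU_mul, np_vAU_inv,
      ← hβγ]
    rw [e3, eb, ef, e2]
    exact satakePairPolynomial_twoTwo_identity hβ2 hγ2 hβ0 hγ0 hx hy hx0 hl0

end DataOn

end Summit.Langlands.Langlands.Cruxes.ReducibleInducesSquare.Sketch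

end
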